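import Mathlib
import Summits.CriticalPhenomena.PercolationContinuityZ3.Theorems.PercNearOneGluingNoHeavyLowerTailPendantStarGluing
import Summits.CriticalPhenomena.PercolationContinuityZ3.Theorems.PercNearOneGluingNoHeavyLowerTailPocketMomentsMeanConnection
import HarnessLib

/-!
# `NoHeavyLowerTail` (stmt-CriticalPhenomena-4575) — the crux's conclusion holds for every DEPTH-TWO observer:
# the lower tail of the pocket size is `O(√t)` uniformly in `|A|` and the number of pendant stars

Support file (depth prover `nh-dp-blobmono`, respawn g5; `--supports stmt-CriticalPhenomena-4575`).  No definitions,
no named facts, no sorries.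

`μ = prodBernoulli w` on `Fin n`, relays `A`, observer `o ∉ A`, `N = |{a ∈ A : o ↔ a}|`, `E N = Σ_a μ(o ↔ a)`,
pairwise relay unreliability `μ(a ↮ a') ≤ t`.  For a DEPTH-TWO observer (every non-relay `x` with `w s(o,x) ≠ 0`
has all its other positive-weight pairs in `A`): `pendantStar_relayTargetGluing` (file `…PendantStarGluing.lean`)
gives `μ(o ↔ A, o ↮ a') ≤ √t` for every relay `a'`, and the Markov link
`PocketMoments.lowerTail_mul_le_eventGluing` turns this into

* `pendantStar_lowerTail` — **`(E N − θ) · μ(1 ≤ N ≤ θ) ≤ E N · √t`** for every `θ`, i.e.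
  `μ(1 ≤ N ≤ ρ·E N) ≤ √t/(1 − ρ)` for every `ρ < 1`: the ONE-CUT / lower-tail conclusion of the crux (with a
  modulus, which is all the crux needs — `Theorems.noHeavyLowerTail_of_oneCut_modulus`) ON THE CLASS OF
  DEPTH-TWO OBSERVERS, `|A|`- and star-uniformly.  Previously this was known with reliability measured in
  `G − o` (LEAD-GEN5 §4b corollary) or for one/two pendant stars with level restrictions (CIL files of hp-2/hp-4).
-/

namespace Summit.CriticalPhenomena.PercolationContinuityZ3.Theorems

open MeasureTheory Set
open Literature.Probability.LatticeModels (prodBernoulli)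
open Literature.Probability.Percolation (BondConfig openConn)

noncomputable section
open Classical

variable {n : ℕ}

/-- **Lower tail of the pocket size for depth-two observers.**  `o ∉ A` depth-two (pendant-star) observer,
`μ(a ↮ a') ≤ t` for all `a, a' ∈ A`; then for every `θ`:
`(E N − θ) · μ(1 ≤ N ≤ θ) ≤ E N · √t`. [this work; cite: KozmaNitzan2024, Conjecture 3 (p. 15)] -/
theorem pendantStar_lowerTail (w : Sym2 (Fin n) → unitInterval) (A : Finset (Fin n)) (o : Fin n) (t θ : ℝ)
    (hoA : o ∉ A)
    (hpend : ∀ x : Fin n, x ≠ o → x ∉ A → w s(o, x) ≠ 0 →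
      ∀ y : Fin n, y ≠ o → y ∉ A → y ≠ x → w s(x, y) = 0)
    (hrel : ∀ a ∈ A, ∀ a' ∈ A, (prodBernoulli w).real (openConn a a')ᶜ ≤ t) :
    ((∑ a ∈ A, (prodBernoulli w).real (openConn o a : Set (BondConfig (Fin n)))) - θ) *
        (prodBernoulli w).real {ω : BondConfig (Fin n) |
          1 ≤ (A.filter fun a => ω ∈ openConn o a).card ∧ ((A.filter fun a => ω ∈ openConn o a).card : ℝ) ≤ θ} ≤
      (∑ a ∈ A, (prodBernoulli w).real (openConn o a : Set (BondConfig (Fin n)))) * Real.sqrt t := by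
  refine PocketMoments.lowerTail_mul_le_eventGluing w A o θ (Real.sqrt t) fun a' ha' => ?_
  exact pendantStar_relayTargetGluing w A o a' t ha' hoA hpend fun a ha => hrel a ha a' ha'

/-- The same in the window form: for `ρ < 1` and `E N > 0`,
`μ(1 ≤ N ≤ ρ·E N) ≤ √t / (1 − ρ)`. [this work] -/
theorem pendantStar_lowerTail_window (w : Sym2 (Fin n) → unitInterval) (A : Finset (Fin n)) (o : Fin n) (t ρ : ℝ)
    (hoA : o ∉ A) (hρ : ρ < 1)
    (hEN : 0 < ∑ a ∈ A, (prodBernoulli w).real (openConn o a : Set (BondConfig (Fin n))))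
    (hpend : ∀ x : Fin n, x ≠ o → x ∉ A → w s(o, x) ≠ 0 →
      ∀ y : Fin n, y ≠ o → y ∉ A → y ≠ x → w s(x, y) = 0)
    (hrel : ∀ a ∈ A, ∀ a' ∈ A, (prodBernoulli w).real (openConn a a')ᶜ ≤ t) :
    (prodBernoulli w).real {ω : BondConfig (Fin n) |
        1 ≤ (A.filter fun a => ω ∈ openConn o a).card ∧
          ((A.filter fun a => ω ∈ openConn o a).card : ℝ) ≤
            ρ * ∑ a ∈ A, (prodBernoulli w).real (openConn o a : Set (BondConfig (Fin n)))} ≤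
      Real.sqrt t / (1 - ρ) := by
  set EN : ℝ := ∑ a ∈ A, (prodBernoulli w).real (openConn o a : Set (BondConfig (Fin n))) with hEN'
  set P : ℝ := (prodBernoulli w).real {ω : BondConfig (Fin n) |
        1 ≤ (A.filter fun a => ω ∈ openConn o a).card ∧
          ((A.filter fun a => ω ∈ openConn o a).card : ℝ) ≤ ρ * EN} with hP
  have key := pendantStar_lowerTail w A o t (ρ * EN) hoA hpend hrel
  change (EN - ρ * EN) * P ≤ EN * Real.sqrt t at key
  have h1ρ : 0 < 1 - ρ := by linarith
  have hP0 : 0 ≤ P := measureReal_nonneg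
  have key' : EN * ((1 - ρ) * P) ≤ EN * Real.sqrt t := by
    have : (EN - ρ * EN) * P = EN * ((1 - ρ) * P) := by ring
    rw [this] at key; exact key
  have h2 : (1 - ρ) * P ≤ Real.sqrt t := le_of_mul_le_mul_left key' hEN
  rw [le_div_iff₀ h1ρ]
  linarith [mul_comm (1 - ρ) P]

end

end Summit.CriticalPhenomena.PercolationContinuityZ3.Theorems
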